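import Summits.NavierStokesRegularity.NavierStokesRegularity.Theorems.ExtremiserTransienceNearExtremalTransienceExtremiserLiouvilleConstantSpeedL2FluxEstimate
import HarnessLib

/-!
# Crux `ExtremiserTransience.NearExtremalTransience` (stmt-NavierStokesRegularity-21883), line `extremiser_liouville`,
# stub K1b — L² FLUX LIOUVILLE, part 2/2: a constant-speed divergence-free field with `w − c ∈ L²` is constant (axial far field)

`--supports stmt-NavierStokesRegularity-21883` (helper).  Author: prover seat `ns-el-k1b` (g3).

g2's flux Liouville (`…ConstantSpeedLiouville`, radial cut-off) needs `R⁻¹∫_{R≤‖x‖≤2R}‖w − c‖ → 0`, which fails exactly at the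
`|x|⁻²` (rotlet) rate singled out by the far-field analysis of `Lines/extremiser_liouville_k1b_multiplier.md` (item 7).  Testing
`div V = 0` (`V = w − c`, `⟪V, c⟫ = −‖V‖²/2`) instead against `arctan⟪c,x⟫ · k_T(x₃) · χ_ρ(x₁,x₂)` — an AXIAL cut-off of
length `T` times a TRANSVERSE (square) cut-off of width `ρ` — the lateral leak lives in a slab of bounded height, where
Cauchy–Schwarz against the VOLUME `64Tρ²` of the box costs only `‖V‖_{L²(‖x‖≥ρ)}`:
`½∫ k_Tχ_ρ ‖V‖²/(1+⟪c,x⟫²) ≤ (πC/(4|c₃|T))‖V‖₂² + (πC'/2)(δ/2·∫_{‖x‖≥ρ}‖V‖² + 32T/δ)` for every `δ > 0`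
(`integral_axialCutoff_weight_le`).  Letting `ρ → ∞`, then `δ → ∞`, then `T → ∞`:

* `eq_zero_of_constSpeedDeviation_memLp_two_axial` : **if `V ∈ C¹`, `div V = 0`, `⟪V x, c⟫ = −‖V x‖²/2` with `c` along the
  third axis (`c₀ = c₁ = 0 ≠ c₂`), and `V ∈ L²(ℝ³)`, then `V ≡ 0`**;
* `eq_farField_of_constSpeed_of_memLp_two_axial` : **a `C¹` divergence-free field with `‖w‖ ≡ M = ‖c‖`, `c = (0,0,c₂) ≠ 0` and
  `w − c ∈ L²` is the constant `c`.**  (The general direction `c` follows by conjugating with a rotation,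
  `VectorCalculus.IsDivFree.conj_linearIsometryEquiv`; not done here.)

CONSEQUENCE for K1b: the residue object (constant-speed analytic extended extremiser, far field `c`) has **`w − c ∉ L²(ℝ³)`** —
its `L²` excess energy is infinite; in particular the `|x|⁻²` ROTLET tail (which is `L²`) is excluded, and with item 7 of the
record (no `|x|⁻¹` tail, heuristically) no power-law tail survives.

WHAT THIS IS NOT: K1b is NOT proved (the general-direction reduction and, above all, `w − c ∈ L²` for the residue object are
not established); nothing here proves NS regularity. [folklore]
-/

noncomputable section

open Set Filter Topology MeasureTheory Metric Function
open scoped ENNReal NNReal Topology InnerProductSpace RealInnerProductSpace ContDiff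
open Literature.Analysis.FluidPDE Literature.Analysis

namespace Summit.NavierStokesRegularity.NavierStokesRegularity.Theorems

-- the problem directory repeats the summit name (`NavierStokesRegularity/NavierStokesRegularity`)
set_option linter.dupNamespace false

namespace ExtremiserLiouville

variable {V : EuclideanSpace ℝ (Fin 3) → EuclideanSpace ℝ (Fin 3)} {c : EuclideanSpace ℝ (Fin 3)}

/-! ## The Liouville theorem -/

/-- **L² flux Liouville (axial far field).**  If `V ∈ C¹` is divergence free, `⟪V x, c⟫ = −‖V x‖²/2` with `c₀ = c₁ = 0 ≠ c₂`,
and `‖V‖² ∈ L¹(ℝ³)`, then `V ≡ 0`. [folklore] -/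
theorem eq_zero_of_constSpeedDeviation_sq_integrable_axial (hV : ContDiff ℝ 1 V) (hdiv : VectorCalculus.IsDivFree V)
    (hVc : ∀ x, ⟪V x, c⟫ = -(‖V x‖ ^ 2 / 2)) (hc0 : c 0 = 0) (hc1 : c 1 = 0) (hc2 : c 2 ≠ 0)
    (hL2 : Integrable (fun x => ‖V x‖ ^ 2) volume) : ∀ x, V x = 0 := by
  obtain ⟨A, B, hA, hB, hineq⟩ := integral_axialCutoff_weight_le hV hdiv hVc hc0 hc1 hc2 hL2
  set g : EuclideanSpace ℝ (Fin 3) → ℝ := fun x => ‖V x‖ ^ 2 / (1 + ⟪c, x⟫ ^ 2) with hg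
  have hgc : Continuous g := by
    refine (hV.continuous.norm.pow 2).div (continuous_const.add ((continuous_const.inner continuous_id).pow 2)) fun x => ?_
    have : (0 : ℝ) < 1 + ⟪c, x⟫ ^ 2 := by positivity
    exact this.ne'
  have hg0 : ∀ x, 0 ≤ g x := fun x => by simp only [hg]; positivity
  have hgle : ∀ x, g x ≤ ‖V x‖ ^ 2 := fun x => by
    simp only [hg]
    exact div_le_self (sq_nonneg _) (by nlinarith [sq_nonneg ⟪c, x⟫])
  have hgint : Integrable g volume :=
    Integrable.mono' hL2 hgc.aestronglyMeasurable (Eventually.of_forall fun x => by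
      rw [Real.norm_eq_abs, abs_of_nonneg (hg0 x)]; exact hgle x)
  set e₂ : EuclideanSpace ℝ (Fin 3) := EuclideanSpace.single (2 : Fin 3) (1 : ℝ) with he₂
  have hk_cont : ∀ T : ℝ, Continuous fun x : EuclideanSpace ℝ (Fin 3) => cutoff T (x 2) := fun T =>
    (contDiff_cutoff (n := 1) T).continuous.comp (PiLp.continuous_apply 2 _ (2 : Fin 3))
  have hχ_cont : ∀ ρ : ℝ, Continuous fun x : EuclideanSpace ℝ (Fin 3) => cutoff ρ (x - (x 2) • e₂) := fun ρ =>
    (contDiff_cutoff (n := 1) ρ).continuous.comp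
      (continuous_id.sub ((PiLp.continuous_apply 2 _ (2 : Fin 3)).smul continuous_const))
  -- Step 1: `ρ → ∞` (tail of `‖V‖²` and `χ_ρ → 1`), for fixed `T, δ`
  have htail : Tendsto (fun ρ : ℝ => ∫ x in {x : EuclideanSpace ℝ (Fin 3) | ρ ≤ ‖x‖}, ‖V x‖ ^ 2) atTop (𝓝 0) := by
    have h : Tendsto (fun ρ : ℝ => ∫ x, {x : EuclideanSpace ℝ (Fin 3) | ρ ≤ ‖x‖}.indicator (fun x => ‖V x‖ ^ 2) x)
        atTop (𝓝 (∫ _x : EuclideanSpace ℝ (Fin 3), (0 : ℝ))) := by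
      refine tendsto_integral_filter_of_dominated_convergence (fun x => ‖V x‖ ^ 2) ?_ ?_ hL2 ?_
      · exact Eventually.of_forall fun ρ =>
          (hL2.indicator ((isClosed_le continuous_const continuous_norm).measurableSet :
            MeasurableSet {x : EuclideanSpace ℝ (Fin 3) | ρ ≤ ‖x‖})).aestronglyMeasurable
      · refine Eventually.of_forall fun ρ => Eventually.of_forall fun x => ?_
        rw [Real.norm_eq_abs, abs_of_nonneg (indicator_nonneg (fun _ _ => sq_nonneg _) _)]
        by_cases hx : x ∈ {x : EuclideanSpace ℝ (Fin 3) | ρ ≤ ‖x‖}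
        · rw [indicator_of_mem hx]
        · rw [indicator_of_notMem hx]; exact sq_nonneg _
      · refine Eventually.of_forall fun x => ?_
        refine (tendsto_const_nhds (x := (0 : ℝ))).congr' ?_
        filter_upwards [eventually_gt_atTop ‖x‖] with ρ hρ
        rw [indicator_of_notMem (show x ∉ {x : EuclideanSpace ℝ (Fin 3) | ρ ≤ ‖x‖} from fun h => (not_le.2 hρ) h)]
    simp only [integral_zero] at h
    refine h.congr fun ρ => ?_
    exact integral_indicator (isClosed_le continuous_const continuous_norm).measurableSet
  have hstep1 : ∀ T δ : ℝ, 0 < T → 0 < δ →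
      (∫ x, cutoff T (x 2) * g x) ≤ A / T * (∫ x, ‖V x‖ ^ 2) + B * (T / δ) := by
    intro T δ hT hδ
    -- the left side is the limit of the doubly cut-off integrals
    have hlim : Tendsto (fun ρ : ℝ => ∫ x, cutoff T (x 2) * cutoff ρ (x - (x 2) • e₂) * g x) atTop
        (𝓝 (∫ x, cutoff T (x 2) * g x)) := by
      refine tendsto_integral_filter_of_dominated_convergence (fun x => ‖V x‖ ^ 2) ?_ ?_ hL2 ?_
      · exact Eventually.of_forall fun ρ => (((hk_cont T).mul (hχ_cont ρ)).mul hgc).aestronglyMeasurable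
      · refine Eventually.of_forall fun ρ => Eventually.of_forall fun x => ?_
        rw [Real.norm_eq_abs, abs_of_nonneg (mul_nonneg (mul_nonneg (cutoff_nonneg _ _) (cutoff_nonneg _ _)) (hg0 x))]
        have hprod : cutoff T (x 2) * cutoff ρ (x - (x 2) • e₂) ≤ 1 :=
          mul_le_one₀ (cutoff_le_one _ _) (cutoff_nonneg _ _) (cutoff_le_one _ _)
        calc cutoff T (x 2) * cutoff ρ (x - (x 2) • e₂) * g x ≤ 1 * g x := mul_le_mul_of_nonneg_right hprod (hg0 x)
          _ = g x := one_mul _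
          _ ≤ ‖V x‖ ^ 2 := hgle x
      · refine Eventually.of_forall fun x => ?_
        refine (tendsto_const_nhds (x := cutoff T (x 2) * g x)).congr' ?_
        filter_upwards [eventually_ge_atTop ‖x - (x 2) • e₂‖, eventually_gt_atTop (0 : ℝ)] with ρ hρ hρ0
        rw [cutoff_eq_one hρ0 hρ, mul_one]
    have hup : Tendsto (fun ρ : ℝ => A / T * (∫ x, ‖V x‖ ^ 2) +
        B * (δ * (∫ x in {x : EuclideanSpace ℝ (Fin 3) | ρ ≤ ‖x‖}, ‖V x‖ ^ 2) + T / δ)) atTop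
        (𝓝 (A / T * (∫ x, ‖V x‖ ^ 2) + B * (δ * 0 + T / δ))) :=
      tendsto_const_nhds.add (((htail.const_mul δ).add tendsto_const_nhds).const_mul B)
    rw [mul_zero, zero_add] at hup
    exact le_of_tendsto_of_tendsto hlim hup ((eventually_gt_atTop 0).mono fun ρ hρ => hineq T ρ δ hT hρ hδ)
  -- Step 2: `δ → ∞`: `∫ k_T g ≤ A/T · ∫‖V‖²`
  have hstep2 : ∀ T : ℝ, 0 < T → (∫ x, cutoff T (x 2) * g x) ≤ A / T * (∫ x, ‖V x‖ ^ 2) := by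
    intro T hT
    refine le_of_forall_pos_le_add fun ε hε => ?_
    have hδ : 0 < (B * T + 1) / ε := by positivity
    have h := hstep1 T ((B * T + 1) / ε) hT hδ
    have hBT : B * (T / ((B * T + 1) / ε)) ≤ ε := by
      rw [div_div_eq_mul_div, mul_div_assoc']
      rw [div_le_iff₀ (by positivity)]
      nlinarith [hB, hT.le, hε]
    linarith
  -- Step 3: `T → ∞`: `∫ g ≤ 0`
  have hZ0 : 0 ≤ ∫ x, ‖V x‖ ^ 2 := integral_nonneg fun x => sq_nonneg _
  have hlimT : Tendsto (fun T : ℝ => ∫ x, cutoff T (x 2) * g x) atTop (𝓝 (∫ x, g x)) := by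
    refine tendsto_integral_filter_of_dominated_convergence (fun x => ‖V x‖ ^ 2) ?_ ?_ hL2 ?_
    · exact Eventually.of_forall fun T => ((hk_cont T).mul hgc).aestronglyMeasurable
    · refine Eventually.of_forall fun T => Eventually.of_forall fun x => ?_
      rw [Real.norm_eq_abs, abs_of_nonneg (mul_nonneg (cutoff_nonneg _ _) (hg0 x))]
      calc cutoff T (x 2) * g x ≤ 1 * g x := mul_le_mul_of_nonneg_right (cutoff_le_one _ _) (hg0 x)
        _ ≤ ‖V x‖ ^ 2 := by rw [one_mul]; exact hgle x
    · refine Eventually.of_forall fun x => ?_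
      refine (tendsto_const_nhds (x := g x)).congr' ?_
      filter_upwards [eventually_ge_atTop ‖(x 2 : ℝ)‖, eventually_gt_atTop (0 : ℝ)] with T hT hT0
      rw [cutoff_eq_one hT0 hT, one_mul]
  have hupT : Tendsto (fun T : ℝ => A / T * (∫ x, ‖V x‖ ^ 2)) atTop (𝓝 (0 * ∫ x, ‖V x‖ ^ 2)) :=
    (tendsto_const_nhds.div_atTop tendsto_id).mul_const _
  rw [zero_mul] at hupT
  have hgle0 : (∫ x, g x) ≤ 0 :=
    le_of_tendsto_of_tendsto hlimT hupT ((eventually_gt_atTop 0).mono fun T hT => hstep2 T hT)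
  have hg_zero : ∫ x, g x = 0 := le_antisymm hgle0 (integral_nonneg hg0)
  -- a continuous nonnegative integrable function with zero integral vanishes
  have hae := (integral_eq_zero_iff_of_nonneg_ae (Eventually.of_forall hg0) hgint).1 hg_zero
  have hfun : g = fun _ => (0 : ℝ) :=
    (Continuous.ae_eq_iff_eq volume hgc (continuous_const (y := (0 : ℝ)))).1 hae
  intro x
  have hgx : ‖V x‖ ^ 2 / (1 + ⟪c, x⟫ ^ 2) = 0 := congrFun hfun x
  rw [div_eq_zero_iff] at hgx
  rcases hgx with h | h
  · exact norm_eq_zero.1 (pow_eq_zero_iff two_ne_zero |>.1 h)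
  · exact absurd h (by positivity)

/-- **A constant-speed divergence-free `C¹` field with `w − c ∈ L²` is constant** (far field along the third axis,
`c = (0, 0, c₂)`, `c₂ ≠ 0`, `‖w‖ ≡ ‖c‖`): the `|x|⁻²` (rotlet) regime of the K1b residue is excluded. [folklore] -/
theorem eq_farField_of_constSpeed_of_sq_integrable_axial {w : EuclideanSpace ℝ (Fin 3) → EuclideanSpace ℝ (Fin 3)}
    (hw : ContDiff ℝ 1 w) (hdiv : VectorCalculus.IsDivFree w) {M : ℝ} (hM : ∀ x, ‖w x‖ = M) (hcM : ‖c‖ = M)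
    (hc0 : c 0 = 0) (hc1 : c 1 = 0) (hc2 : c 2 ≠ 0)
    (hL2 : Integrable (fun x => ‖w x - c‖ ^ 2) volume) : ∀ x, w x = c := by
  set V : EuclideanSpace ℝ (Fin 3) → EuclideanSpace ℝ (Fin 3) := fun x => w x - c with hVdef
  have hV : ContDiff ℝ 1 V := hw.sub contDiff_const
  have hVdiv : VectorCalculus.IsDivFree V := isDivFree_sub_const hdiv c
  have hVc : ∀ x, ⟪V x, c⟫ = -(‖V x‖ ^ 2 / 2) := fun x => by
    have h : ‖c + V x‖ = ‖c‖ := by simp only [hVdef, add_sub_cancel]; rw [hM x, hcM]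
    exact (inner_eq_of_norm_add_eq h).1
  have h0 := eq_zero_of_constSpeedDeviation_sq_integrable_axial hV hVdiv hVc hc0 hc1 hc2 hL2
  intro x
  have := h0 x
  simpa [hVdef, sub_eq_zero] using this

end ExtremiserLiouville

end Summit.NavierStokesRegularity.NavierStokesRegularity.Theorems

end
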